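import Literature.NumberTheory.GaloisRepresentations.HomDualIdeleReadout
import Literature.NumberTheory.GaloisRepresentations.HomDualLocalLayer
import Literature.NumberTheory.GaloisRepresentations.HomDualUnramifiedSplitting
import Literature.NumberTheory.EllipticCurves.KummerSelmerStructure
import HarnessLib

/-!
# The LOCAL half of Milne I Lemma 4.13 for the canonical presentation: every local class is a local readout,
# the readout maps take values in the local layer, and at unramified places the map may be taken unit-valued

Topic `NumberTheory/GaloisRepresentations`; namespace `Literature.NumberTheory.GaloisRepresentations.HomDual`.
One definition with body (`localReadout`) and theorems; no named fact, no instance, no `sorry`.  Sequel to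
`HomDualIdeleReadout` (door-c6 g17: `IdeleProjection`, `readout`, (R1), (R2)), `HomDualLocalLayer` (the local layer is
finite Galois), `HomDualRestrictField` (F4c `dualδ₀_units_restrict_surjective`), `HomDualUnramifiedSplitting` (F5
`exists_unitValued_of_unramified`), `HomDualReadoutRestrict` (inertia bridge), `PresentationGaloisModules`
(`pres_isSES`, `permutedBasis_presModule₂`, `uniformIsotropy_presIndex`, `smul_presIndex_eq_of_apply_eq_one`).

For a number field `K`, a finite `n`-torsion discrete Galois module `ρ` on `M`, its canonical presentation
`0 → N₁ → P → M → 0` (`FreePresentation.presentationComplex ρ`, layer `K(M)`), and an extension field `K'/K` of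
characteristic `0` (every completion `K_v`):
* **`localReadout ρ n hM K' h := H¹(e⁻¹)(δ₀^{K'} h) ∈ H¹(K', ρ^∨(1))`** for a `Γ_{K'}`-equivariant `h : N₁ → K̄'ˣ`
  (`e = tateDualRestrictUnitsIso`); the idèle readout factors through it: `readout ρ n hM π f = localReadout (π_v ∘ f)`
  (`readout_eq_localReadout`, `rfl`).
* **`localReadout_surjective`** — EVERY class of `H¹(K', ρ^∨(1))` is `localReadout h` for some `h` (F4c at the
  permutation presentation: uniform isotropy `Γ_{K(M)}`, permuted basis; the local layer `K'(ι K(M))` is finite Galois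
  by `HomDualLocalLayer`).  Milne I Lemma 4.13, the factor at `v ∈ T`.
* **`unitsVal_readoutMap_mem_localLayer`** / `unitsVal_mem_localLayer` — the values of such an `h` lie in the local
  layer `K'(ι K(M))` (`N₁` is `U_{K(M)}`-trivial, Galois descent `InfiniteGalois.fixedField_fixingSubgroup`); this is
  the datum the idèle ASSEMBLY consumes (`K_v(ι K(M)) ≅ K(M)_{w_v}`, `exists_place_algHom_compositum`).
* **`exists_unitValued_localReadout_eq`** — at a finite place `v ∤ n` where `ρ` is unramified, an UNRAMIFIED class is
  `localReadout h` for an `h` with values of valuation `0` (F5 + the inertia bridge `galUnr_le_stabilizer_of_isUnramifiedAt`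
  fed by `smul_presIndex_eq_of_apply_eq_one`).  Milne I Lemma 4.13, the factor at `v ∉ T`.
Together: hypothesis (R3) of `middleExact_allPlaces_of_readout` for the readout of `HomDualIdeleReadout` is REDUCED to
the pure idèle assembly "given `Γ_{K_v}`-equivariant `h_v : N₁ → (K_v·ι K(M))ˣ ⊆ K̄_vˣ`, unit-valued off a finite set,
there is `f : N₁ ⟶ J̄` with `π_v ∘ f = h_v` for all `v`" (door-c5).
HONEST FRAMING: no case of Poitou–Tate or BSD is proved here.

## References
* J. S. Milne, *Arithmetic Duality Theorems* (2nd ed. 2006), I Lemma 4.13 (proof), I §4. [MilneADT2006]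
* J. W. S. Cassels, A. Fröhlich (eds.), *Algebraic Number Theory* (1967), Ch. II §10, Ch. VII §9.7. [CasselsFrohlichANT1967]
* J.-P. Serre, *Local Fields* (1979), IV §4, X §1 Prop. 2. [SerreLocalFields1979]
-/

noncomputable section

open CategoryTheory NumberField IsDedekindDomain
open Field (absoluteGaloisGroup)
open scoped ContRepresentation

namespace Literature.NumberTheory.GaloisRepresentations

namespace HomDual

open Literature.Algebra.Homology Literature.Algebra.Homology.DiscreteRep DiscreteGaloisModule IdeleClassBar
  FreePresentation DGMBridge HomPermutation IsNonarchimedeanLocalField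

/-! ## §1 Values of equivariant maps out of a `U_L`-trivial object lie in the local layer `K'(ι L)` -/

section Values

variable {K : Type} [Field K] (K' : Type) [Field K'] [Algebra K K'] [CharZero K']
variable (L : IntermediateField K (AlgebraicClosure K)) [FiniteDimensional K L] [IsGalois K L]
variable (X : DiscreteRepCat ℤ (absoluteGaloisGroup K)) [Module.Finite ℤ (LCarrier X)]

/-- **Values of a `Γ_{K'}`-equivariant `h : X → K̄'ˣ` out of a `Γ_L`-trivial `X` lie in the local layer `K'(ι L)`**
(`Gal(K̄'/K'(ιL)) = res⁻¹(Γ_L)` fixes them; Galois descent in `K̄'/K'`).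
[cite: CasselsFrohlichANT1967, Ch. II §10][cite: MilneADT2006, I Lemma 4.13 (proof)] -/
theorem unitsVal_mem_localLayer (hX : ∀ σ ∈ absGaloisFixingSubgroup L, ∀ x : X.obj.V, X.obj.ρ σ x = x)
    (h : (homGaloisModule ((toDGM X).restrictField K') (units K')).toTopRep.ρ.invariants) (x : LCarrier X) :
    ((unitsVal K' ((show LCarrier X →ₗ[ℤ] UnitsCarrier K' from
        (h.1 : DiscreteRep.HomCarrier (LCarrier X) (UnitsCarrier K'))) x) : (AlgebraicClosure K')ˣ) :
      AlgebraicClosure K') ∈ localLayer K K' L := by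
  haveI := normal_localLayer K K' L
  haveI : IsGalois K' (AlgebraicClosure K') := IsGalois.mk
  rw [← InfiniteGalois.fixedField_fixingSubgroup (localLayer K K' L), IntermediateField.mem_fixedField_iff]
  intro τ hτ
  have hτ' : (τ : absoluteGaloisGroup K') ∈ absGaloisFixingSubgroup (localLayer K K' L) :=
    (mem_absGaloisFixingSubgroup_iff _ _).2 ((IntermediateField.mem_fixingSubgroup_iff _ _).1 hτ)
  have hres : absGaloisRestrict K K' τ ∈ absGaloisFixingSubgroup L := by
    rw [← comap_absGaloisRestrict_eq K K' L] at hτ'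
    exact hτ'
  have hinv := (mem_invariants_iff ((toDGM X).restrictField K') (units K') h.1).1 h.2 τ x
  have hfix : ((toDGM X).restrictField K') τ x = x := by
    rw [GaloisRep.restrictField_apply, toDGM_apply, hX _ hres]
    rfl
  rw [hfix] at hinv
  -- `h x = τ • h x` in `K̄'ˣ`
  have hval := congrArg (fun u : UnitsCarrier K' => ((unitsVal K' u : (AlgebraicClosure K')ˣ) : AlgebraicClosure K'))
    hinv
  simp only [unitsVal_apply, Units.coe_smul] at hval
  exact hval.symm

end Values

/-! ## §2 The local readout over an extension field, and its surjectivity (Milne I 4.13, `v ∈ T`) -/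

section LocalReadout

variable {K : Type} [Field K] [NumberField K]
variable {M : Type} [AddCommGroup M] [TopologicalSpace M] [DiscreteTopology M] [Finite M]
variable (ρ : DiscreteGaloisModule K M) (n : ℕ) [NeZero n]

/-- **The local readout over `K'`**: `h ↦ H¹(e⁻¹)(δ₀^{K'} h) ∈ H¹(K', ρ^∨(1))` for a `Γ_{K'}`-equivariant `h : N₁ → K̄'ˣ`
out of the relation module of the canonical presentation of `ρ` (`e = tateDualRestrictUnitsIso : ρ^∨(1)|_{K'} ≅
Hom_ℤ(M|_{K'}, K̄'ˣ)`). [cite: MilneADT2006, I Lemma 4.13 (proof)] -/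
def localReadout (hM : ∀ m : M, n • m = 0) (K' : Type) [Field K'] [Algebra K K'] [CharZero K']
    (h : (haveI := moduleFinite_presModule₁ ρ
      (homGaloisModule ((presModule₁ ρ).restrictField K') (units K')).toTopRep.ρ.invariants)) :
    galoisCohomology ((ρ.tateDual n).restrictField K') 1 :=
  haveI := moduleFinite_presModule₁ ρ
  haveI := moduleFinite_presModule₂ ρ
  cohomologyMap (tateDualRestrictUnitsIso K K' ρ n hM).inv 1
    (dualδ₀ ((presModule₁ ρ).restrictField K') ((presModule₂ ρ).restrictField K') (ρ.restrictField K') (units K')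
      (restrictIntertwining (presModule₁ ρ) (presModule₂ ρ) (presIncl ρ))
      (restrictIntertwining (presModule₂ ρ) ρ (presProj ρ))
      (isSES_restrict (presModule₁ ρ) (presModule₂ ρ) ρ (pres_isSES ρ)) (baer_unitsCarrier K') h)

/-- **The idèle readout factors through the local readout**: `readout ρ n hM π f = localReadout (π_v ∘ f)` (`rfl`).
[cite: MilneADT2006, I Lemma 4.13 (proof)] -/
theorem readout_eq_localReadout (hM : ∀ m : M, n • m = 0) {v : Place K} (π : IdeleProjection K v)
    (f : (presentationComplex ρ).X₁ ⟶ ideleBarD K) :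
    readout ρ n hM π f =
      (haveI : CharZero (Place.Completion v) := charZero_of_algebra (K := K) (Place.Completion v)
       haveI := moduleFinite_presModule₁ ρ
       localReadout ρ n hM (Place.Completion v) (readoutInvariant π (presentationComplex ρ).X₁ f)) := rfl

/-- **Milne I Lemma 4.13, the factor at `v ∈ T`: every class of `H¹(K', ρ^∨(1))` is a local readout** (F4c at the
permutation presentation; the local layer `K'(ι K(M))` is finite Galois over `K'`).
[cite: MilneADT2006, I Lemma 4.13 (proof)][cite: SerreLocalFields1979, X §1 Prop. 2] -/
theorem localReadout_surjective (hM : ∀ m : M, n • m = 0) (K' : Type) [Field K'] [Algebra K K'] [CharZero K'] :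
    Function.Surjective (localReadout ρ n hM K') := by
  haveI := moduleFinite_presModule₁ ρ
  haveI := moduleFinite_presModule₂ ρ
  haveI := (presentationLayer ρ).finiteDimensional
  haveI := (presentationLayer ρ).isGalois
  haveI := normal_localLayer K K' (presentationLayer ρ).1
  haveI := finiteDimensional_localLayer K K' (presentationLayer ρ).1
  intro t
  obtain ⟨h, hh⟩ := dualδ₀_units_restrict_surjective (K' := K') (ρX := presModule₁ ρ) (ρZ := ρ)
    (hstab := uniformIsotropy_presIndex ρ) (he := permutedBasis_presModule₂ ρ) (hS := pres_isSES ρ)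
    ((cohomologyMap (tateDualRestrictUnitsIso K K' ρ n hM).hom 1).hom t)
  refine ⟨h, ?_⟩
  change (cohomologyMap (tateDualRestrictUnitsIso K K' ρ n hM).inv 1).hom _ = t
  rw [hh]
  exact cohomologyMap_inv_hom_apply (tateDualRestrictUnitsIso K K' ρ n hM) 1 t

/-- **The values of a readout map lie in the local layer `K'(ι K(M))`** (for the idèle assembly: they lie in the
field `K_v(ι K(M)) ≅ K(M)_{w_v}`). [cite: CasselsFrohlichANT1967, Ch. II §10, Ch. VII §9.7] -/
theorem unitsVal_mem_localLayer_presentation (K' : Type) [Field K'] [Algebra K K'] [CharZero K']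
    (h : (haveI := moduleFinite_presModule₁ ρ
      (homGaloisModule ((presModule₁ ρ).restrictField K') (units K')).toTopRep.ρ.invariants))
    (x : LCarrier (presentationComplex ρ).X₁) :
    ((unitsVal K' ((show LCarrier (presentationComplex ρ).X₁ →ₗ[ℤ] UnitsCarrier K' from
        (h.1 : DiscreteRep.HomCarrier (LCarrier (presentationComplex ρ).X₁) (UnitsCarrier K'))) x) :
        (AlgebraicClosure K')ˣ) : AlgebraicClosure K') ∈ localLayer K K' (presentationLayer ρ).1 := by
  haveI := moduleFinite_presModule₁ ρ
  haveI := (presentationLayer ρ).finiteDimensional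
  haveI := (presentationLayer ρ).isGalois
  refine unitsVal_mem_localLayer K' (presentationLayer ρ).1 (presentationComplex ρ).X₁ (fun σ hσ y => ?_) h x
  exact presentationComplex_X₁_trivial ρ σ
    ((IntermediateField.mem_fixingSubgroup_iff _ _).2 ((mem_absGaloisFixingSubgroup_iff _ _).1 hσ)) y

/-- The same for the readout map `π_v ∘ f` of an `f : N₁ ⟶ J̄` at a place `v`. [cite: CasselsFrohlichANT1967, Ch. VII §9.7] -/
theorem unitsVal_readoutMap_mem_localLayer {v : Place K} (π : IdeleProjection K v)
    (f : (presentationComplex ρ).X₁ ⟶ ideleBarD K) (x : LCarrier (presentationComplex ρ).X₁) :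
    ((unitsVal (Place.Completion v) (readoutMap π (presentationComplex ρ).X₁ f x) :
        (AlgebraicClosure (Place.Completion v))ˣ) : AlgebraicClosure (Place.Completion v)) ∈
      localLayer K (Place.Completion v) (presentationLayer ρ).1 := by
  haveI : CharZero (Place.Completion v) := charZero_of_algebra (K := K) (Place.Completion v)
  haveI := moduleFinite_presModule₁ ρ
  exact unitsVal_mem_localLayer_presentation ρ (Place.Completion v) (readoutInvariant π (presentationComplex ρ).X₁ f) x

end LocalReadout

/-! ## §3 Unramified places: unit-valued maps (Milne I 4.13, `v ∉ T`) -/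

section Unramified

variable {K : Type} [Field K] [NumberField K]
variable {M : Type} [AddCommGroup M] [TopologicalSpace M] [DiscreteTopology M] [Finite M]
variable (ρ : DiscreteGaloisModule K M) (n : ℕ) [NeZero n]

/-- `H¹(e)` carries the unramified subgroup of `H¹(K_v, ρ^∨(1))` into that of `H¹(K_v, Hom_ℤ(M, K̄_vˣ))`
(restriction to `K_v^nr` commutes with the change of coefficients). [cite: MilneADT2006, I §2 (unramified classes)] -/
theorem cohomologyMap_tateDualRestrictUnitsIso_mem_unramifiedSubgroup (hM : ∀ m : M, n • m = 0)
    (v : HeightOneSpectrum (𝓞 K)) [CharZero (v.adicCompletion K)]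
    {t : galoisCohomology ((ρ.tateDual n).restrictField (v.adicCompletion K)) 1}
    (ht : t ∈ unramifiedSubgroup ((ρ.tateDual n).restrictField (v.adicCompletion K)) 1) :
    (cohomologyMap (tateDualRestrictUnitsIso K (v.adicCompletion K) ρ n hM).hom 1).hom t ∈
      unramifiedSubgroup (homGaloisModule (ρ.restrictField (v.adicCompletion K)) (units (v.adicCompletion K))) 1 := by
  change galoisCohomology.map (tateDualRestrictUnitsIso K (v.adicCompletion K) ρ n hM).hom.hom 1 t ∈ _
  have ht' := (DiscreteGaloisModule.mem_unramifiedSubgroup_iff _ _ _).1 ht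
  refine (DiscreteGaloisModule.mem_unramifiedSubgroup_iff _ _ _).2 ?_
  refine (galoisCohomology.res_map_one (maxUnramified (v.adicCompletion K)) _ t).trans ?_
  rw [ht', map_zero]

/-- **Milne I Lemma 4.13, the factor at `v ∉ T`: an UNRAMIFIED class of `H¹(K_v, ρ^∨(1))` is the local readout of a
UNIT-VALUED equivariant `h : N₁ → K̄_vˣ`**, at a finite place `v ∤ n` (`n • M = 0`) where `ρ` is unramified
(`exists_unitValued_of_unramified` for the restricted permutation presentation; the local inertia fixes the index
set `Fin |M| × Γ_K/U_{K(M)}` because `ker ρ` does: `galUnr_le_stabilizer_of_isUnramifiedAt`).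
[cite: MilneADT2006, I Lemma 4.13 (proof), I §4][cite: SerreLocalFields1979, IV §4] -/
theorem exists_unitValued_localReadout_eq (hM : ∀ m : M, n • m = 0) (v : HeightOneSpectrum (𝓞 K))
    [CharZero (v.adicCompletion K)] (hur : GaloisRep.IsUnramifiedAt v ρ)
    (t : galoisCohomology ((ρ.tateDual n).restrictField (v.adicCompletion K)) 1)
    (ht : t ∈ unramifiedSubgroup ((ρ.tateDual n).restrictField (v.adicCompletion K)) 1) :
    ∃ h : (haveI := moduleFinite_presModule₁ ρ
      (homGaloisModule ((presModule₁ ρ).restrictField (v.adicCompletion K)) (units (v.adicCompletion K))).toTopRep.ρ.invariants),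
      localReadout ρ n hM (v.adicCompletion K) h = t ∧
      ∀ x : LCarrier (presentationComplex ρ).X₁,
        ordQ (v.adicCompletion K) ((show LCarrier (presentationComplex ρ).X₁ →ₗ[ℤ] UnitsCarrier (v.adicCompletion K) from
          (h.1 : DiscreteRep.HomCarrier (LCarrier (presentationComplex ρ).X₁) (UnitsCarrier (v.adicCompletion K)))) x) = 0 := by
  haveI := moduleFinite_presModule₁ ρ
  haveI := moduleFinite_presModule₂ ρ
  obtain ⟨h₀, hh₀⟩ := localReadout_surjective ρ n hM (v.adicCompletion K) t
  letI := resAction K (v.adicCompletion K) (PresIndex ρ)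
  have hunr : dualδ₀ ((presModule₁ ρ).restrictField (v.adicCompletion K)) ((presModule₂ ρ).restrictField (v.adicCompletion K))
      (ρ.restrictField (v.adicCompletion K)) (units (v.adicCompletion K))
      (restrictIntertwining (presModule₁ ρ) (presModule₂ ρ) (presIncl ρ))
      (restrictIntertwining (presModule₂ ρ) ρ (presProj ρ))
      (isSES_restrict (presModule₁ ρ) (presModule₂ ρ) ρ (pres_isSES ρ)) (baer_unitsCarrier (v.adicCompletion K)) h₀ ∈
      (homGaloisModule (ρ.restrictField (v.adicCompletion K)) (units (v.adicCompletion K))).unramifiedSubgroup 1 := by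
    have hδ : dualδ₀ ((presModule₁ ρ).restrictField (v.adicCompletion K)) ((presModule₂ ρ).restrictField (v.adicCompletion K))
        (ρ.restrictField (v.adicCompletion K)) (units (v.adicCompletion K))
        (restrictIntertwining (presModule₁ ρ) (presModule₂ ρ) (presIncl ρ))
        (restrictIntertwining (presModule₂ ρ) ρ (presProj ρ))
        (isSES_restrict (presModule₁ ρ) (presModule₂ ρ) ρ (pres_isSES ρ)) (baer_unitsCarrier (v.adicCompletion K)) h₀ =
        (cohomologyMap (tateDualRestrictUnitsIso K (v.adicCompletion K) ρ n hM).hom 1).hom t := by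
      rw [← hh₀]
      exact (cohomologyMap_tateDualRestrictUnitsIso_hom_inv_apply K (v.adicCompletion K) ρ n hM 1 _).symm
    rw [hδ]
    exact cohomologyMap_tateDualRestrictUnitsIso_mem_unramifiedSubgroup ρ n hM v ht
  obtain ⟨h', hδ', hord⟩ := exists_unitValued_of_unramified (presModuleBasis ρ)
    (isSES_restrict (presModule₁ ρ) (presModule₂ ρ) ρ (pres_isSES ρ)) (NeZero.ne n) hM
    (permutedBasis_restrict (permutedBasis_presModule₂ ρ))
    (fun b => galUnr_le_stabilizer_of_isUnramifiedAt v ρ hur (fun γ b hγ => smul_presIndex_eq_of_apply_eq_one ρ γ b hγ) b)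
    h₀ hunr
  refine ⟨h', ?_, hord⟩
  rw [← hh₀]
  change (cohomologyMap (tateDualRestrictUnitsIso K (v.adicCompletion K) ρ n hM).inv 1).hom _ =
    (cohomologyMap (tateDualRestrictUnitsIso K (v.adicCompletion K) ρ n hM).inv 1).hom _
  rw [hδ']

end Unramified

end HomDual

end Literature.NumberTheory.GaloisRepresentations

end
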